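import Literature.NumberTheory.Automorphic.SmoothedCuspForms
import HarnessLib

/-!
# Continuous functions in `L²_cusp(GL_n(𝔸_K) ⧸ A_G GL_n(K))` are cusp forms

Topic `NumberTheory/Automorphic`; sequel to `SmoothedCuspForms`. There the smoothing
`S_η f (x) = ∫ η(g) f(g⁻¹ • x) dg` of a class `f ∈ L²_cusp` (the closure in `L²(μ)` of the classes
of the continuous square-integrable cusp forms, `cuspidalSubspace n K μ` of `GLnCuspidalSpectrum`)
was shown to be a continuous cusp form. Here we let `η` run through an approximate identity and
prove the converse inclusion of Borel–Jacquet 1979, §4.4 / Getz–Hahn 2024, §6.5 (definition of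
`L²_cusp` as the closure of the continuous functions with vanishing constant terms):

* `norm_orbitalSmoothing_sub_le` — the approximate-identity estimate for a continuous action
  `G ↷ X`: if `η ≥ 0`, `∫ η = 1` and `‖f (g⁻¹ • y) - f y‖ ≤ ε` on the support of `η`, then
  `‖S_η f (y) - f y‖ ≤ ε`.
* `setIntegral_blockFundamentalDomain_eq_zero_of_toLp_mem` — for a **continuous** `f ∈ ℒ²(μ)`
  whose class lies in `L²_cusp`, `∫_{𝓕₀} f (x (1 + X)) dν(X) = 0` on the block fundamental domain
  `𝓕₀` (the smoothed constant terms vanish by `setIntegral_smoothedForm_unipotent_eq_zero`, and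
  `S_η f → f` uniformly on the compact `x (1 + closure 𝓕₀)` as `supp η → 1`, by joint continuity
  of the action and Urysohn weights `exists_continuous_invariant_nonneg_pos`).
* `constantTermVanishes_of_toLp_mem_cuspidalSubspace` — hence all constant terms of `f` vanish
  (every Haar measure, every measurable fundamental domain: periodicity and
  `IsAddFundamentalDomain.setIntegral_eq`, as in `constantTermVanishes_smoothedForm`);
  `isContinuousCuspForm_of_toLp_mem_cuspidalSubspace` and the characterisation
  `isContinuousCuspForm_iff_toLp_mem_cuspidalSubspace`: **a continuous square-integrable function
  is a cusp form iff its class lies in `L²_cusp`.**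

This is step F4b of the decomposition of `AutomorphicRepsGL.exists_cuspidalRepData_of_L2`
(`AutomorphicRepsGLCuspidalL2`): together with the continuity of automorphic forms and the
inversion dictionary `cuspConditionGL_invQuot_iff` it gives
`AutomorphicRepsGL.isCuspFormGL_invQuot_of_mem_cuspidalSubspace`. Everything here is proved.

## References

* A. Borel, H. Jacquet, *Automorphic forms and automorphic representations*, Proc. Sympos. Pure
  Math. 33 (1979), part 1, §4.4 [BorelJacquet1979].
* J. R. Getz, H. Hahn, *An Introduction to Automorphic Representations* (2024), §6.5, p. 120
  [GetzHahn2024].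
-/

noncomputable section

open MeasureTheory Measure Set Filter IsDedekindDomain NumberField
open _root_.Topology

namespace Literature.NumberTheory.Automorphic

/-! ### The approximate-identity estimate -/

section ApproximateIdentity

variable {G X : Type*} [Group G] [TopologicalSpace G] [IsTopologicalGroup G]
  [MeasurableSpace G] [BorelSpace G]
  [MulAction G X] [TopologicalSpace X] [ContinuousSMul G X]
  (ν : Measure G) [IsFiniteMeasureOnCompacts ν]

/-- **Approximate identity estimate.** For a continuous compactly supported weight `η ≥ 0` with
`∫ η dν = 1`, a continuous `f : X → ℂ` and a point `y`, if `‖f (g⁻¹ • y) - f y‖ ≤ ε` for every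
`g` in the support of `η`, then the orbital smoothing `S_η f (y) = ∫ η(g) f(g⁻¹ • y) dν(g)`
satisfies `‖S_η f (y) - f y‖ ≤ ε` (write `S_η f (y) - f y = ∫ η(g) (f(g⁻¹ • y) - f y) dν`).
[folklore] -/
theorem norm_orbitalSmoothing_sub_le {η : G → ℝ} (hη : Continuous η)
    (hηs : HasCompactSupport η) (hη0 : 0 ≤ η) (hη1 : ∫ g, η g ∂ν = 1)
    {f : X → ℂ} (hf : Continuous f) {y : X} {ε : ℝ}
    (hV : ∀ g ∈ Function.support η, ‖f (g⁻¹ • y) - f y‖ ≤ ε) :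
    ‖orbitalSmoothing ν (fun g => (η g : ℂ)) f y - f y‖ ≤ ε := by
  have hηc : Continuous fun g => (η g : ℂ) := Complex.continuous_ofReal.comp hη
  have hηsc : HasCompactSupport fun g => (η g : ℂ) := hηs.comp_left Complex.ofReal_zero
  have hint1 : Integrable (fun g => (η g : ℂ) • f (g⁻¹ • y)) ν :=
    (hηc.smul (hf.comp (continuous_inv.smul continuous_const))).integrable_of_hasCompactSupport
      hηsc.smul_right
  have hint2 : Integrable (fun g => (η g : ℂ) • f y) ν :=
    (hηc.smul continuous_const).integrable_of_hasCompactSupport hηsc.smul_right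
  have hint3 : Integrable (fun g => (η g : ℂ) • (f (g⁻¹ • y) - f y)) ν :=
    (hηc.smul ((hf.comp (continuous_inv.smul continuous_const)).sub continuous_const))
      |>.integrable_of_hasCompactSupport hηsc.smul_right
  have h1 : ∫ g, (η g : ℂ) • f y ∂ν = f y := by
    rw [integral_smul_const, integral_complex_ofReal, hη1, Complex.ofReal_one, one_smul]
  have hdiff : orbitalSmoothing ν (fun g => (η g : ℂ)) f y - f y =
      ∫ g, (η g : ℂ) • (f (g⁻¹ • y) - f y) ∂ν := by
    unfold orbitalSmoothing
    conv_lhs => rw [← h1]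
    rw [← integral_sub hint1 hint2]
    congr 1 with g
    rw [smul_sub]
  rw [hdiff]
  have hpt : ∀ g, ‖(η g : ℂ) • (f (g⁻¹ • y) - f y)‖ ≤ η g * ε := by
    intro g
    rw [norm_smul, Complex.norm_real, Real.norm_of_nonneg (hη0 g)]
    by_cases hg : η g = 0
    · rw [hg, zero_mul, zero_mul]
    · exact mul_le_mul_of_nonneg_left (hV g (Function.mem_support.2 hg)) (hη0 g)
  calc ‖∫ g, (η g : ℂ) • (f (g⁻¹ • y) - f y) ∂ν‖
      ≤ ∫ g, ‖(η g : ℂ) • (f (g⁻¹ • y) - f y)‖ ∂ν := norm_integral_le_integral_norm _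
    _ ≤ ∫ g, η g * ε ∂ν := integral_mono hint3.norm
        ((hη.integrable_of_hasCompactSupport hηs).mul_const ε) hpt
    _ = ε := by rw [integral_mul_const, hη1, one_mul]

end ApproximateIdentity

/-! ### Continuous functions with class in `L²_cusp` -/

section Cuspidal

variable {n : ℕ} {K : Type} [Field K] [NumberField K]
  {μ : Measure (AdelicGroupData.gl n K).automorphicQuotient}
  [(AdelicGroupData.gl n K).IsAutomorphicMeasure μ]

attribute [local instance] adelicBorel borelSpace_adelic locallyCompactSpace_adelic
  secondCountableTopology_gl_adelic

/-- **Continuous functions in `L²_cusp` have vanishing constant terms on the block fundamental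
domain.** For a continuous `f ∈ ℒ²(μ)` whose `L²`-class lies in the cuspidal subspace and
`0 < k < n`, `∫_{𝓕₀} f (x (1 + X)) dν(X) = 0` for every additive Haar measure `ν` on `𝔫_k(𝔸_K)` and
every `x ∈ GL_n(𝔸_K)`. Proof: for a weight `η ∈ C_c(GL_n(𝔸_K))`, `η ≥ 0`, `∫ η = 1`, the smoothed
class `S_η [f]` is a continuous function agreeing pointwise with `S_η f` and its constant term on
`𝓕₀` vanishes (`setIntegral_smoothedForm_unipotent_eq_zero`); by joint continuity of
`(g, y) ↦ f (g⁻¹ • y)` and compactness of `x (1 + closure 𝓕₀)` one finds, for `ε > 0`, a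
neighbourhood `U` of `1` with `‖f(g⁻¹ • y) - f y‖ ≤ ε` there, and a weight supported in `U`
(`exists_continuous_invariant_nonneg_pos`), whence `‖∫_{𝓕₀} f (x(1+X)) dν‖ ≤ ε ν(𝓕₀)`.
Borel–Jacquet 1979, §4.4; Getz–Hahn 2024, §6.5. [cite: BorelJacquet1979, §4.4] -/
theorem setIntegral_blockFundamentalDomain_eq_zero_of_toLp_mem {k : ℕ} (hk : 0 < k) (hkn : k < n)
    {f : (AdelicGroupData.gl n K).automorphicQuotient → ℂ} (hfc : Continuous f)
    (hf : MemLp f 2 μ) (hcusp : hf.toLp f ∈ cuspidalSubspace n K μ)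
    (ν : Measure (blockNilpotent n k (AdeleRing (𝓞 K) K))) [ν.IsAddHaarMeasure]
    (x : (AdelicGroupData.gl n K).Adelic) :
    ∫ X in blockFundamentalDomain n k K, f ((AdelicGroupData.gl n K).toAutomorphicQuotient
        (x * glUnipotent n k K (Multiplicative.ofAdd X))) ∂ν = 0 := by
  set 𝓕 := blockFundamentalDomain n k K with h𝓕def
  -- the points `x (1 + X)` of the quotient
  let pt : blockNilpotent n k (AdeleRing (𝓞 K) K) → (AdelicGroupData.gl n K).automorphicQuotient :=
    fun X => (AdelicGroupData.gl n K).toAutomorphicQuotient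
      (x * glUnipotent n k K (Multiplicative.ofAdd X))
  have hptc : Continuous pt := by
    refine (AdelicGroupData.gl n K).continuous_toAutomorphicQuotient.comp ?_
    exact continuous_const.mul continuous_glUnipotent_ofAdd
  -- the compact set of points over `closure 𝓕`
  set C : Set (AdelicGroupData.gl n K).automorphicQuotient := pt '' closure 𝓕 with hCdef
  have hC : IsCompact C := (isCompact_closure_blockFundamentalDomain n k K).image hptc
  have h𝓕fin : ν 𝓕 < ⊤ := measure_blockFundamentalDomain_lt_top n k K ν
  have h𝓕m : MeasurableSet 𝓕 := measurableSet_blockFundamentalDomain n k K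
  -- `f ∘ pt` is bounded on `𝓕`, hence integrable there
  obtain ⟨M, hM⟩ : ∃ M, ∀ X ∈ closure 𝓕, ‖f (pt X)‖ ≤ M :=
    (isCompact_closure_blockFundamentalDomain n k K).exists_bound_of_continuousOn
      (hfc.comp hptc).continuousOn
  have hfint : IntegrableOn (fun X => f (pt X)) 𝓕 ν :=
    Measure.integrableOn_of_bounded (M := M) h𝓕fin.ne (hfc.comp hptc).aestronglyMeasurable
      ((ae_restrict_iff' h𝓕m).2 (Eventually.of_forall fun X hX => hM X (subset_closure hX)))
  -- the joint continuity estimate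
  have key : ∀ ε : ℝ, 0 < ε → ‖∫ X in 𝓕, f (pt X) ∂ν‖ ≤ ε * ν.real 𝓕 := by
    intro ε hε
    -- a neighbourhood `U` of `1` on which `f (g⁻¹ • y)` is `ε`-close to `f y`, uniformly on `C`
    have hF : Continuous fun z : (AdelicGroupData.gl n K).Adelic ×
        (AdelicGroupData.gl n K).automorphicQuotient => f (z.1⁻¹ • z.2) - f z.2 :=
      (hfc.comp (continuous_fst.inv.smul continuous_snd)).sub (hfc.comp continuous_snd)
    have hP : ∀ y ∈ C, ∀ᶠ z : (AdelicGroupData.gl n K).Adelic ×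
        (AdelicGroupData.gl n K).automorphicQuotient in 𝓝 (1, y), ‖f (z.1⁻¹ • z.2) - f z.2‖ < ε := by
      intro y _
      refine (isOpen_lt hF.norm continuous_const).mem_nhds ?_
      rw [Set.mem_setOf_eq, inv_one, one_smul, sub_self, norm_zero]
      exact hε
    have hev := hC.eventually_forall_of_forall_eventually
      (P := fun g y => ‖f (g⁻¹ • y) - f y‖ < ε) hP
    obtain ⟨U, hUsub, hUo, hU1⟩ := mem_nhds_iff.1 hev
    have hUC : ∀ g ∈ U, ∀ y ∈ C, ‖f (g⁻¹ • y) - f y‖ < ε := fun g hg => hUsub hg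
    -- a weight supported in `U`
    obtain ⟨η, hη, hηs, hη0, -, hη1, hsupp⟩ :=
      exists_continuous_invariant_nonneg_pos (⊥ : Subgroup (AdelicGroupData.gl n K).Adelic)
        (by rw [Subgroup.coe_bot]; exact isCompact_singleton) hUo
        (by rw [Subgroup.coe_bot, Set.singleton_subset_iff]; exact hU1)
    have hIpos : 0 < ∫ g, η g ∂(adelicHaar n K) :=
      hη.integral_pos_of_hasCompactSupport_nonneg_nonzero hηs hη0 hη1.ne'
    -- normalise: `η' = η / ∫ η`
    set c : ℝ := (∫ g, η g ∂(adelicHaar n K))⁻¹ with hcdef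
    have hc0 : 0 ≤ c := inv_nonneg.2 hIpos.le
    set η' : (AdelicGroupData.gl n K).Adelic → ℝ := fun g => c * η g with hη'def
    have hη' : Continuous η' := continuous_const.mul hη
    have hη's : HasCompactSupport η' := hηs.mul_left
    have hη'0 : 0 ≤ η' := fun g => mul_nonneg hc0 (hη0 g)
    have hη'1 : ∫ g, η' g ∂(adelicHaar n K) = 1 := by
      simp only [hη'def, integral_const_mul, hcdef]
      exact inv_mul_cancel₀ hIpos.ne'
    have hsupp' : ∀ g ∈ Function.support η', g ∈ U := by
      intro g hg
      refine hsupp ?_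
      rw [Function.mem_support] at hg ⊢
      exact fun h0 => hg (by simp [hη'def, h0])
    -- the smoothed class: a continuous function with vanishing constant term on `𝓕`
    set S := smoothedForm η' (hf.toLp f) with hSdef
    have hSc : Continuous S := continuous_smoothedForm hη' hη's _
    have hS0 : ∫ X in 𝓕, S (pt X) ∂ν = 0 :=
      setIntegral_smoothedForm_unipotent_eq_zero hk hkn hη' hη's hcusp ν x
    -- pointwise `S = S_η' f` and the `ε`-estimate on `𝓕`
    have hSpt : ∀ X ∈ 𝓕, ‖f (pt X) - S (pt X)‖ ≤ ε := by
      intro X hX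
      have hrepr : S (pt X) = orbitalSmoothing (adelicHaar n K) (fun g => (η' g : ℂ)) f (pt X) :=
        orbitalSmoothing_adelicHaar_congr_ae (μ := μ) _ (MemLp.coeFn_toLp hf) _
      rw [hrepr, norm_sub_rev]
      refine norm_orbitalSmoothing_sub_le (adelicHaar n K) hη' hη's hη'0 hη'1 hfc fun g hg => ?_
      exact (hUC g (hsupp' g hg) (pt X) ⟨X, subset_closure hX, rfl⟩).le
    have hSint : IntegrableOn (fun X => S (pt X)) 𝓕 ν := by
      obtain ⟨M', hM'⟩ : ∃ M', ∀ X ∈ closure 𝓕, ‖S (pt X)‖ ≤ M' :=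
        (isCompact_closure_blockFundamentalDomain n k K).exists_bound_of_continuousOn
          (hSc.comp hptc).continuousOn
      exact Measure.integrableOn_of_bounded (M := M') h𝓕fin.ne (hSc.comp hptc).aestronglyMeasurable
        ((ae_restrict_iff' h𝓕m).2 (Eventually.of_forall fun X hX => hM' X (subset_closure hX)))
    have hrw : ∫ X in 𝓕, f (pt X) ∂ν = ∫ X in 𝓕, (f (pt X) - S (pt X)) ∂ν := by
      rw [integral_sub hfint hSint, hS0, sub_zero]
    rw [hrw]
    exact norm_setIntegral_le_of_norm_le_const h𝓕fin hSpt
  -- conclusion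
  have hle : ‖∫ X in 𝓕, f (pt X) ∂ν‖ ≤ 0 := by
    refine le_of_forall_pos_le_add fun ε hε => ?_
    rw [zero_add]
    have hpos : 0 < ν.real 𝓕 + 1 := by positivity
    have := key (ε / (ν.real 𝓕 + 1)) (div_pos hε hpos)
    refine this.trans ?_
    rw [div_mul_eq_mul_div, div_le_iff₀ hpos]
    nlinarith [measureReal_nonneg (μ := ν) (s := 𝓕)]
  exact norm_le_zero_iff.1 hle

/-- **Continuous functions in `L²_cusp` have vanishing constant terms** (every additive Haar
measure, every measurable fundamental domain of `𝔫_k(K)`): the integrand `X ↦ f (x (1 + X))` is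
continuous and `𝔫_k(K)`-periodic, hence bounded and integrable on any fundamental domain (all of
the same finite measure), and its integral equals the one over the block fundamental domain
(`IsAddFundamentalDomain.setIntegral_eq`), which vanishes
(`setIntegral_blockFundamentalDomain_eq_zero_of_toLp_mem`). Borel–Jacquet 1979, §4.4. [cite: BorelJacquet1979, §4.4] -/
theorem constantTermVanishes_of_toLp_mem_cuspidalSubspace
    {f : (AdelicGroupData.gl n K).automorphicQuotient → ℂ} (hfc : Continuous f)
    (hf : MemLp f 2 μ) (hcusp : hf.toLp f ∈ cuspidalSubspace n K μ)
    {k : ℕ} (hk : 0 < k) (hkn : k < n) :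
    ConstantTermVanishes n K f k := by
  intro ν _ 𝓕 h𝓕 x
  haveI : Countable (rationalBlock n k K) := rationalBlock_countable
  set 𝓕₀ := blockFundamentalDomain n k K with h𝓕₀def
  have h𝓕₀ : IsAddFundamentalDomain (rationalBlock n k K) 𝓕₀ ν :=
    isAddFundamentalDomain_blockFundamentalDomain n k K ν
  let I : blockNilpotent n k (AdeleRing (𝓞 K) K) → ℂ := fun X =>
    f ((AdelicGroupData.gl n K).toAutomorphicQuotient
      (x * glUnipotent n k K (Multiplicative.ofAdd X)))
  have hIc : Continuous I := by
    refine hfc.comp ((AdelicGroupData.gl n K).continuous_toAutomorphicQuotient.comp ?_)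
    exact continuous_const.mul continuous_glUnipotent_ofAdd
  have hIper : ∀ (γ : rationalBlock n k K) (X : blockNilpotent n k (AdeleRing (𝓞 K) K)),
      I (γ +ᵥ X) = I X := fun γ X =>
    toAutomorphicQuotient_mul_glUnipotent_vadd f x γ X
  -- a global bound by periodicity
  obtain ⟨M, hM⟩ : ∃ M, ∀ X ∈ closure 𝓕₀, ‖I X‖ ≤ M :=
    (isCompact_closure_blockFundamentalDomain n k K).exists_bound_of_continuousOn hIc.continuousOn
  have hbd : ∀ X, ‖I X‖ ≤ M := fun X => by
    obtain ⟨γ, hγ⟩ := (existsUnique_vadd_mem_blockFundamentalDomain n k K X).exists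
    rw [← hIper γ X]
    exact hM _ (subset_closure hγ)
  have hmeas : ν 𝓕 = ν 𝓕₀ := h𝓕.measure_eq h𝓕₀
  have hfin : ν 𝓕 < ⊤ := hmeas ▸ measure_blockFundamentalDomain_lt_top n k K ν
  refine ⟨Measure.integrableOn_of_bounded (M := M) hfin.ne hIc.aestronglyMeasurable
    (Eventually.of_forall hbd), ?_⟩
  change ∫ X in 𝓕, I X ∂ν = 0
  rw [h𝓕.setIntegral_eq h𝓕₀ hIper]
  exact setIntegral_blockFundamentalDomain_eq_zero_of_toLp_mem hk hkn hfc hf hcusp ν x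

/-- **A continuous square-integrable function whose class lies in `L²_cusp` is a continuous cusp
form.** Borel–Jacquet 1979, §4.4; Getz–Hahn 2024, §6.5. [cite: BorelJacquet1979, §4.4] -/
theorem isContinuousCuspForm_of_toLp_mem_cuspidalSubspace
    {f : (AdelicGroupData.gl n K).automorphicQuotient → ℂ} (hfc : Continuous f)
    (hf : MemLp f 2 μ) (hcusp : hf.toLp f ∈ cuspidalSubspace n K μ) :
    IsContinuousCuspForm n K μ f :=
  ⟨hfc, hf, fun _ hk hkn => constantTermVanishes_of_toLp_mem_cuspidalSubspace hfc hf hcusp hk hkn⟩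

/-- **The continuous functions in `L²_cusp` are exactly the continuous cusp forms**: for a
continuous `f ∈ ℒ²(μ)`, `f` is a continuous cusp form iff its `L²`-class lies in the cuspidal
subspace (`⇐`: `isContinuousCuspForm_of_toLp_mem_cuspidalSubspace`; `⇒`:
`mem_cuspidalSubspace_of_isContinuousCuspForm`). Borel–Jacquet 1979, §4.4; Getz–Hahn 2024, §6.5
(definition of `L²_cusp`). [cite: BorelJacquet1979, §4.4] -/
theorem isContinuousCuspForm_iff_toLp_mem_cuspidalSubspace
    {f : (AdelicGroupData.gl n K).automorphicQuotient → ℂ} (hfc : Continuous f)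
    (hf : MemLp f 2 μ) :
    IsContinuousCuspForm n K μ f ↔ hf.toLp f ∈ cuspidalSubspace n K μ :=
  ⟨fun h => mem_cuspidalSubspace_of_isContinuousCuspForm h,
    fun h => isContinuousCuspForm_of_toLp_mem_cuspidalSubspace hfc hf h⟩

end Cuspidal

end Literature.NumberTheory.Automorphic
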